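import Literature.MathematicalPhysics.QuantumLattice.FermiRG.BGM2006Sec2Setup
import Literature.MathematicalPhysics.QuantumLattice.SSectorNesting
import Mathlib.Data.Nat.Factorial.Basic
import HarnessLib

/-!
# Benfatto–Giuliani–Mastropietro 2006, §2.6–§2.8: the tree expansion, the modified running couplings,
the sector constraints and Theorem 2.1 (power counting)

Topic `Literature/MathematicalPhysics/QuantumLattice/FermiRG` (typer-wave file F1b of the cell
`gate-hubbard-kl`; source BGM06 = Ann. Henri Poincaré 7 (2006) 809–898, arXiv:cond-mat/0507686, §2.6–§2.8;
locators `p00NN:Lnn` = chunk/line of the `lit read` render of the arXiv TeX; continues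
`BGM2006Sec2Setup.lean` (F1a), whose conventions (tree normalisation, `γ = 4`, dispersion families
`E : ℤ → ℝ × (Fin 2 → ℝ) → ℂ`) are in force).

## What the tree already has (cited, not restated)

* §2.6 (2.61)–(2.68a): the truncated expectations and their tree expansion with interpolated Gram
  determinants ("it is well known that" (2.66)–(2.67a)) are PROVED in the tree:
  `GrassmannTruncatedExpectation`, `FermionicTreeExpansion.ursellOf_moment_eq_treeSum` (the
  Battle–Brydges–Federbush formula (2.66)), `FermionicTreeExpansionGramDetBound` /
  `GramDeterminantBound.norm_det_momentumKernel_le` (the Gram–Hadamard bound used in (2.80)),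
  `FermionicTreeExpansionTrees.norm_ursellOf_moment_le_sum_lineSets` (the `n!`-free bound as a sum over
  anchored trees `T`).  The Gallavotti–Nicolò trees `τ ∈ 𝒯_{h,n}` themselves (items 1)–6), p0012:L60–p0013)
  are not in the tree; this file introduces only their POWER-COUNTING SKELETON `GNTree` (a vertex knows
  its number of external fields `|P_v|` and its subtrees; scales are `h_v = h + depth`), which is all the
  right-hand side of (2.77) depends on.
* §2.7 (2.69): the s-sectors for `E_h ≡ ε` and their nesting are `SSectorNesting.sSector`,
  `sSector_child_subset`, `sSector_subset_of_le` (and `AngularSectors.sectorIndex_div_pow` is the map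
  `ω ↦ ω'(j; ω)` of p0016:L24); (2.70)–(2.71): per-leg Fourier multipliers of kernels are
  `SectorisedKernelNorm.sectorisedKernel` / `legConv` (Young: `sectorisedKernelNorm_legConv_le`);
* §2.8 (2.73): the constraint set `{Ω : χ(Ω) = 1}` at GENERAL filling (momentum conservation modulo
  `2πℤ²`, umklapp kept) is `SectorisedKernelNorm.bgmSectorSet`; the sectorised `L¹–L^∞` norm implicit in
  (2.76)/(2.79) is `sectorisedKernelNorm` / `bgmNorm`, and THE SINGLE-SCALE STEP in that norm — the
  tree's form of (2.77) — is `SectorisedEffectiveActionBound.hubbardSectorKernelNorm_effAction_le`;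
  the phase-space count (2.80) at finite `(β, L)` is `HubbardSectorPhaseSpaceCount.card_filter_freqMomentum_le`.

## What this file adds

* §2.6: `GNTree` / `GNForest` (mutual inductives) with `numEndpoints` (`n`, and `m₄(v)` for a subtree),
  `extLegs` (`|P_v|`; endpoints of type `λ` have `4`), `len` (`s_v`), the admissibility predicate of
  items 3)–4) and of §2.6 p0013:L62 ("`|P_v| = 2` is not allowed and vertices with `|P_v| = 4` are
  necessarily endpoints" — for `v ≠ v₀`, which carry `ℛ`);
* §2.7: the s-sectors `S_{h,ω}` with a moving dispersion (2.69) `bgmSSector` (= `sSector` at `E_h ≡ ε`,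
  `bgmSSector_of_const`), the PROVED nesting `S_{h+1,ω} ⊇ S_{h,2ω} ∪ S_{h,2ω+1}` under the explicit
  closeness `|ε_h - ε_{h+1}| ≤ 3e₀γ^h` that (2.36) provides (`bgmSSector_child_subset`), the envelope
  functions `F̃_{h,ω}` as a predicate (`IsSectorEnvelope`; BGM fix no formula), the modification
  operator `𝔉_{2p,h,ω} * G` (2.70) `bgmSectorModify`, and the smallness condition (2.71a)
  `BGMCouplingSmallness`;
* §2.8: the constraint `χ(Ω_v)` (2.73) as a `Prop` (`BGMSectorCompatible`), the exponent
  `δ(p) = 1 - p/4 + 𝟙(p ≥ 10)` (2.78) `bgmDelta` with the Remark's `δ(|P_v|) ≤ -½` PROVED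
  (`bgmDelta_le_neg_half`), the right-hand side of (2.77) as a function of the tree skeleton
  (`GNTree.bgmTreeBound`), the exponents of the four displayed inputs of the proof — (2.80) Gram–Hadamard
  `gramExp`, (2.81) tree lines `lineExp`, (2.83) sector sums `sectorExp` — and the PROVED assembly
  "Theorem 2.1 in the case `F = 1` follows by combining the bounds (2.80), (2.81), (2.82) and (2.83)"
  (p0016:L12): `GNTree.bgm_powerCounting` — the exponents add up EXACTLY to `h(5/2 - ¾|P_{v₀}|) +
  Σ_{v not e.p.} δ(|P_v|)` for every admissible skeleton (endpoint scales cancel telescopically).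

## What is NOT typed, and why (GAP report to the cell's GAP-LEDGER)

The SUBJECT of Theorem 2.1, `J^{(F)}_{h,n}(τ, P, T) = Σ_{Ω∖Ω_ext} [Π_v χ(Ω_v)] ∫d(x_{v₀}∖x*) |W^{(mod)}_{τ,P,Ω,T}(x_{v₀})|`
(2.76), is the sector sum of the `L¹` norm of the renormalised tree-expansion values `W^{(mod)}` of
(2.61)–(2.72) (field labels `f`, the sets `P_v`, anchored trees `T_v`, interpolated determinants, the
`ℒ/ℛ` operation at every vertex, modified endpoint kernels).  That object is not in the tree and is not
typable in this wave (it IS the formalisation of the BGM expansion); hence Theorem 2.1 is recorded here as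
(i) its hypotheses ((2.36) = `BGMSmoothness`, (2.71a) = `BGMCouplingSmallness`, `c₀ = U₀|h_β|` small), (ii)
its right-hand side `bgmTreeBound` with (2.78), (iii) the proved power-counting assembly, and (iv) the
printed statement verbatim in the docstring of `GNTree.bgmTreeBound` — NOT as a named `Prop` fact with a
fake subject.  The analytic inputs are: (2.80) ← tree Gram bound + Lemma 2.2 (F1a `BGM2006_Lemma_2_2`);
(2.81) ← (2.52a); (2.82) ← (2.71a); (2.83) ← the sector counting lemma (App. A3, Lemma 3.1; wave file F2c)
and its generalisation Lemma 2.4 (F2a).  Likewise (2.84)–(2.96) (the inductive organisation of the sector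
sums: `Ω_v^{(j)}`, `c`-vertices) are proof internals of (2.83), quoted only.

No named `Prop` facts are introduced in this file (net debt 0); no `sorry`, axioms, instances, notation.

## Sources

* [BGM06] G. Benfatto, A. Giuliani, V. Mastropietro, Ann. Henri Poincaré 7 (2006) 809–898,
  arXiv:cond-mat/0507686, §2.6–§2.8. [BenfattoGiulianiMastropietro2006]
* [BGM03] G. Benfatto, A. Giuliani, V. Mastropietro, Ann. Henri Poincaré 4 (2003) 137–193, §2.7, §3.1
  (the tree expansion and the `c`-vertices this section summarises). [BenfattoGiulianiMastropietro2003]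
-/

noncomputable section

open Real Set Complex MeasureTheory
open scoped Topology

namespace Literature.MathematicalPhysics.QuantumLattice.FermiRG

/-! ### §2.6 (BGM06.S2.6, p0012:L22) — the power-counting skeleton of the trees `τ ∈ 𝒯_{h,n}` -/

mutual
/-- **The power-counting skeleton of a Gallavotti–Nicolò tree** (§2.6 items 1)–6)): a vertex is either
an ENDPOINT of type `λ` (item 3): a contribution `λ_{h_v-1}` of the form (2.25), four external fields) or a
(trivial or non-trivial) VERTEX carrying its number `p = |P_v|` of external fields and the forest of the
`s_v` subtrees rooted at the vertices immediately following it, which sit one scale higher (item 2): every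
vertex lies on a vertical line `h_v`, children on `h_v + 1`).  The root scale `h`, the field labels, the
sets `P_v` themselves and the anchored trees `T_v` are not part of the skeleton. BGM06.S2.6 · §2.6 items
1)–6) · p0012:L60. [cite: BenfattoGiulianiMastropietro2006, §2.6] -/
inductive GNTree : Type
  | endpt : GNTree
  | vtx (p : ℕ) (children : GNForest) : GNTree

/-- The ordered forest of subtrees of a vertex (`s_v` = its length). [cite: BenfattoGiulianiMastropietro2006, §2.6] -/
inductive GNForest : Type
  | nil : GNForest
  | cons (t : GNTree) (rest : GNForest) : GNForest
end

mutual
/-- `n` = the number of endpoints of the tree (its ORDER, item 1)); for the subtree at `v` this is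
`m₄(v)`, "the number of endpoints of type `λ` following `v`" ((2.83)). [cite: BenfattoGiulianiMastropietro2006, §2.6 item 1)] -/
def GNTree.numEndpoints : GNTree → ℕ
  | .endpt => 1
  | .vtx _ cs => cs.numEndpoints

/-- Number of endpoints of a forest. [cite: BenfattoGiulianiMastropietro2006, §2.6 item 1)] -/
def GNForest.numEndpoints : GNForest → ℕ
  | .nil => 0
  | .cons t f => t.numEndpoints + f.numEndpoints
end

/-- `|P_v|` of the root vertex of a (sub)tree: `4` for an endpoint of type `λ`. [cite: BenfattoGiulianiMastropietro2006, §2.6 (2.64)] -/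
def GNTree.extLegs : GNTree → ℕ
  | .endpt => 4
  | .vtx p _ => p

/-- `s_v` = the number of subtrees of a vertex. [cite: BenfattoGiulianiMastropietro2006, §2.6 (2.62)] -/
def GNForest.len : GNForest → ℕ
  | .nil => 0
  | .cons _ f => f.len + 1

/-- `Σ_{i=1}^{s_v} |P_{v_i}|` over the roots of a forest ((2.80)). [cite: BenfattoGiulianiMastropietro2006, §2.8 (2.80)] -/
def GNForest.sumExtLegs : GNForest → ℕ
  | .nil => 0
  | .cons t f => t.extLegs + f.sumExtLegs

mutual
/-- Admissibility of the labels for the power counting: every non-endpoint vertex has an EVEN number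
`|P_v| ≥ 4` of external fields ("`|P_v| = 2` is not allowed", p0013:L62; `|P_v| = 4` occurs at `v₀` only,
`|P_v| ≥ 6` below it; the cases `|P_{v₀}| ∈ {0, 2}` — free energy, self-energy — are the `F = 0` line of
(2.77) and are excluded here). [cite: BenfattoGiulianiMastropietro2006, §2.6 (constraints on P_v)] -/
def GNTree.Admissible : GNTree → Prop
  | .endpt => True
  | .vtx p cs => Even p ∧ 4 ≤ p ∧ cs.Admissible

/-- Admissibility of every tree of a forest. [cite: BenfattoGiulianiMastropietro2006, §2.6 (constraints on P_v)] -/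
def GNForest.Admissible : GNForest → Prop
  | .nil => True
  | .cons t f => t.Admissible ∧ f.Admissible
end

/-! ### §2.7 (BGM06.S2.7, p0014:L37) — s-sectors, envelopes, modified couplings, the smallness (2.71a) -/

/-- **(2.69), general form** the s-sector `S_{h,ω} = {k⃗ = ρe⃗_r(θ) : |ε_h(k⃗) - μ| ≤ γ^he₀, ζ_{h,ω}(θ) ≠ 0}`
of the scale-`h` dispersion `ε_h = bgmEffDisp β E h`, with angular index `m` (`m = n = -h` anisotropic,
`m = 2n` isotropic).  For `E_h ≡ ε` it is the tree's `sSector` (`bgmSSector_of_const`).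
BGM06.S2.7 · (2.69) · p0014:L48. [cite: BenfattoGiulianiMastropietro2006, §2.7 (2.69)] -/
def bgmSSector (β e₀ μ : ℝ) (E : ℤ → ℝ × (Fin 2 → ℝ) → ℂ) (h : ℤ) (m : ℕ) (ω : ℤ) : Set (Fin 2 → ℝ) :=
  {k | |bgmEffDisp β E h k - μ| ≤ (4 : ℝ) ^ h * e₀ ∧ sectorWeightCirc m ω (polarAngle k) ≠ 0}

/-- At a scale where `E_h(k₀, k⃗) = ε(k⃗)` the general s-sector is the tree's `sSector` (`n = -h`). [cite: BenfattoGiulianiMastropietro2006, §2.7 (2.69)] -/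
theorem bgmSSector_of_const {β e₀ μ : ℝ} {E : ℤ → ℝ × (Fin 2 → ℝ) → ℂ} {n : ℕ}
    (hE : ∀ (k₀ : ℝ) (k : Fin 2 → ℝ), E (-(n : ℤ)) (k₀, k) = ((sqDispersion k : ℝ) : ℂ)) (ω : ℤ) :
    bgmSSector β e₀ μ E (-(n : ℤ)) n ω = sSector e₀ μ n ω := by
  ext k
  have hε : bgmEffDisp β E (-(n : ℤ)) k = sqDispersion k := by
    rw [bgmEffDisp, hE, hE, ← Complex.ofReal_add, ← Complex.ofReal_ofNat, ← Complex.ofReal_div,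
      Complex.ofReal_re]
    ring
  simp only [bgmSSector, sSector, Set.mem_setOf_eq, hε, mul_comm ((4 : ℝ) ^ (-(n : ℤ))) e₀]

/-- **Nesting of the s-sectors across one scale, (2.69)+**: if the effective dispersions of two
consecutive scales are close, `|ε_h(k⃗) - ε_{h+1}(k⃗)| ≤ 3e₀γ^h` (which (2.36) gives for `|U|` small, the
printed "by construction and by the inductive assumption on `E_h(k)`", p0014:L56), then
`S_{h,2ω} ∪ S_{h,2ω+1} ⊆ S_{h+1,ω}` (tree scale indices `n+1 = -h`, `n = -(h+1)`).
[cite: BenfattoGiulianiMastropietro2006, §2.7 (2.69)] -/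
theorem bgmSSector_child_subset {β e₀ μ : ℝ} {E : ℤ → ℝ × (Fin 2 → ℝ) → ℂ} (n : ℕ)
    (hclose : ∀ k : Fin 2 → ℝ,
      |bgmEffDisp β E (-((n : ℤ) + 1)) k - bgmEffDisp β E (-(n : ℤ)) k| ≤ 3 * e₀ * (4 : ℝ) ^ (-((n : ℤ) + 1)))
    (ω : ℤ) :
    bgmSSector β e₀ μ E (-((n : ℤ) + 1)) (n + 1) (2 * ω) ∪ bgmSSector β e₀ μ E (-((n : ℤ) + 1)) (n + 1) (2 * ω + 1) ⊆
      bgmSSector β e₀ μ E (-(n : ℤ)) n ω := by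
  have h4 : (4 : ℝ) ^ (-(n : ℤ)) = 4 * (4 : ℝ) ^ (-((n : ℤ) + 1)) := by
    rw [show (-(n : ℤ)) = -((n : ℤ) + 1) + 1 by ring, zpow_add_one₀ (by norm_num : (4 : ℝ) ≠ 0)]
    ring
  have key : ∀ k, |bgmEffDisp β E (-((n : ℤ) + 1)) k - μ| ≤ (4 : ℝ) ^ (-((n : ℤ) + 1)) * e₀ →
      |bgmEffDisp β E (-(n : ℤ)) k - μ| ≤ (4 : ℝ) ^ (-(n : ℤ)) * e₀ := by
    intro k hk
    have hc := hclose k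
    rw [h4]
    calc |bgmEffDisp β E (-(n : ℤ)) k - μ|
        = |(bgmEffDisp β E (-((n : ℤ) + 1)) k - μ) -
            (bgmEffDisp β E (-((n : ℤ) + 1)) k - bgmEffDisp β E (-(n : ℤ)) k)| := by ring_nf
      _ ≤ |bgmEffDisp β E (-((n : ℤ) + 1)) k - μ| +
            |bgmEffDisp β E (-((n : ℤ) + 1)) k - bgmEffDisp β E (-(n : ℤ)) k| := abs_sub _ _
      _ ≤ (4 : ℝ) ^ (-((n : ℤ) + 1)) * e₀ + 3 * e₀ * (4 : ℝ) ^ (-((n : ℤ) + 1)) := add_le_add hk hc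
      _ = 4 * (4 : ℝ) ^ (-((n : ℤ) + 1)) * e₀ := by ring
  rintro k (⟨hk1, hk2⟩ | ⟨hk1, hk2⟩)
  · exact ⟨key k hk1, sectorWeightCirc_ne_zero_of_child (Or.inl hk2)⟩
  · exact ⟨key k hk1, sectorWeightCirc_ne_zero_of_child (Or.inr hk2)⟩

/-- **The envelope functions `F̃_{h,ω}`** of §2.7 (p0014:L70): "a smooth function equal to `1` on
`S_{h,ω}` and with a support slightly greater than `S_{h,ω}`" — BGM fix no formula, so this is a PREDICATE
on a candidate `F̃`, with the enlarged set `S'` as a parameter. [cite: BenfattoGiulianiMastropietro2006, §2.7 (before (2.70))] -/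
def IsSectorEnvelope (Ftilde : (Fin 2 → ℝ) → ℝ) (S S' : Set (Fin 2 → ℝ)) : Prop :=
  (∀ m : ℕ, ContDiff ℝ m Ftilde) ∧ S ⊆ S' ∧ Set.EqOn Ftilde 1 S ∧ Function.support Ftilde ⊆ S' ∧
    ∀ k, Ftilde k ∈ Set.Icc (0 : ℝ) 1

/-- **(2.70)** the modification operator: for a kernel of `2p` spatial arguments with Fourier transform
`Ĝ(k⃗₁,…,k⃗_{2p})` (`G(x⃗) = ∫dk⃗ (2π)^{-4p} e^{-iΣε_ik⃗_i·x⃗_i} Ĝ(k⃗)`, `ε_i = +1` for `i ≤ p`, `-1` after) and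
a family `ω` of `2p` envelope functions, `(𝔉_{2p,h,ω} * G)(x⃗) = ∫dk⃗ (2π)^{-4p} e^{-iΣε_ik⃗_i·x⃗_i} [Π_i F̃_{h,ω_i}(k⃗_i)] Ĝ(k⃗)`
(momenta over the zone `[-π,π]²`, positions at lattice sites).  The tree's position-space form is
`SectorisedKernelNorm.legConv` / `sectorisedKernel`. BGM06.S2.7 · (2.70) · p0014:L95.
[cite: BenfattoGiulianiMastropietro2006, §2.7 (2.70)] -/
def bgmSectorModify (p : ℕ) (Ftilde : Fin (2 * p) → (Fin 2 → ℝ) → ℝ)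
    (Ghat : (Fin (2 * p) → Fin 2 → ℝ) → ℂ) (x : Fin (2 * p) → Fin 2 → ℤ) : ℂ :=
  ∫ k in Set.pi Set.univ (fun _ : Fin (2 * p) => zoneSq),
    Complex.exp (-(Complex.I *
        ((∑ i : Fin (2 * p), (if (i : ℕ) < p then (1 : ℝ) else -1) * dot2 (k i) (fun j => (x i j : ℝ)) : ℝ) : ℂ))) *
      ((∏ i, Ftilde i (k i) : ℝ) : ℂ) * Ghat k / ((((2 * π) ^ (4 * p) : ℝ)) : ℂ)

/-- **(2.71a)** the smallness condition on the modified running coupling functions at an endpoint: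
`(1/(L²β)) ∫dx_{v*} |λ̃_{h-1,Ω}(x_{v*})| ≤ C|U|`, `∫dx = ∫₀^β dx₀ Σ_{x⃗ ∈ Λ}` per point ((2.7)), for a
quartic kernel `λ̃` of four space-time points (spatial part summed over one period `{0,…,L-1}²` of the
torus `Λ`).  A PREDICATE on `λ̃` (the hypothesis of Theorem 2.1 / Lemma 2.5 / Theorem 3.1 "for any endpoint
`v* ∈ τ`"). BGM06.E2.71a · (2.71a) · p0014:L113. [cite: BenfattoGiulianiMastropietro2006, §2.7 (2.71a)] -/
def BGMCouplingSmallness (β : ℝ) (L : ℕ) (C U : ℝ) (lam : (Fin 4 → ℝ × (Fin 2 → ℤ)) → ℂ) : Prop :=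
  (1 / ((L : ℝ) ^ 2 * β)) *
      ∫ t in Set.pi Set.univ (fun _ : Fin 4 => Set.Icc (0 : ℝ) β),
        ∑ y : Fin 4 → Fin 2 → Fin L, ‖lam (fun i => (t i, fun j => ((y i j : ℕ) : ℤ)))‖ ≤ C * |U|

/-! ### §2.8 (BGM06.S2.8, p0015:L9) — the constraint functions, `δ`, and Theorem 2.1's power counting -/

/-- **(2.73)** the sector constraint at a vertex `v`, as a `Prop` (BGM's `χ(Ω_v)` is its indicator): the
external fields `f ∈ P_v` carry signs `ε(f) = ±1`, scales `h(f)` and anisotropic sector indices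
`ω(f) ∈ O_{h(f)}`; if `|P_v| ≤ 8` the constraint is `∃ k⃗(f) ∈ S_{h(f),ω(f)}` with `Σ_f ε(f)k⃗(f) = 0⃗`
(EXACT momentum conservation — "umklapp processes are impossible if `|P_v| ≤ 8`, because of the condition
on `μ`", p0015:L40), and if `|P_v| ≥ 10` no constraint is imposed ("we discarded any possible constraint
coming from momentum conservation (modulo `2πℤ²`)").  The tree's `SectorisedKernelNorm.bgmSectorSet` is
the all-orders, modulo-`2πℤ²` variant at general filling. BGM06.S2.8 · (2.73) · p0015:L17.
[cite: BenfattoGiulianiMastropietro2006, §2.8 (2.73)] -/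
def BGMSectorCompatible (β e₀ μ : ℝ) (E : ℤ → ℝ × (Fin 2 → ℝ) → ℂ) {q : ℕ}
    (sgn : Fin q → ℤ) (hf : Fin q → ℤ) (ω : Fin q → ℕ) : Prop :=
  10 ≤ q ∨ ∃ k : Fin q → Fin 2 → ℝ,
    (∀ f, k f ∈ bgmSSector β e₀ μ E (hf f) (bgmScaleIdx (hf f)) (ω f)) ∧ ∑ f, (sgn f : ℝ) • k f = 0

/-- **(2.78)** `δ(p) = 1 - p/4 + 𝟙(p ≥ 10)`, the scaling exponent of a cluster with `p = |P_v|` external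
fields. BGM06.E2.77 · (2.78) · p0015:L72. [cite: BenfattoGiulianiMastropietro2006, §2.8 (2.78)] -/
def bgmDelta (p : ℕ) : ℝ := 1 - (p : ℝ) / 4 + if 10 ≤ p then 1 else 0

/-- **Remark after (2.78)** (p0015:L74): "clusters with `|P_v| = 2` are not allowed, and clusters with
`|P_v| = 4` are necessarily endpoints. Then the exponent `δ(|P_v|)` appearing in (2.77) is always `≤ -½`"
— for every even `p ≥ 6`. (Hence the sums over `P` and `τ` in (2.75) converge exponentially, see [BGM03],
and `lim_{L→∞} F_{L,β}` exists and is `O(U)` under the hypotheses of the Theorem — prose.)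
[cite: BenfattoGiulianiMastropietro2006, §2.8 Remark after (2.78)] -/
theorem bgmDelta_le_neg_half {p : ℕ} (hp : Even p) (h6 : 6 ≤ p) : bgmDelta p ≤ -1 / 2 := by
  unfold bgmDelta
  have h6' : (6 : ℝ) ≤ p := by exact_mod_cast h6
  split_ifs with h10
  · have h10' : (10 : ℝ) ≤ p := by exact_mod_cast h10
    linarith
  · push Not at h10
    obtain ⟨r, hr⟩ := hp
    have hp8 : p ≤ 8 := by omega
    have hp8' : (p : ℝ) ≤ 8 := by exact_mod_cast hp8
    linarith

/-- The per-vertex sector-sum exponent of (2.83):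
`σ(p) = ½(p - 3)𝟙(4 ≤ p ≤ 8) + ½(p - 1)𝟙(p ≥ 10)`. BGM06.S2.8 · (2.83) · p0016:L3.
[cite: BenfattoGiulianiMastropietro2006, §2.8 (2.83)] -/
def bgmSigma (p : ℕ) : ℝ :=
  if 4 ≤ p ∧ p ≤ 8 then ((p : ℝ) - 3) / 2 else if 10 ≤ p then ((p : ℝ) - 1) / 2 else 0

/-- The dimensional bookkeeping behind (2.77): `δ(p) = 5/2 - ¾p + σ(p)` for every even `p ≥ 4`
(`5/2` from the two tree-line factors `γ^{-h_v(s_v-1)}` of (2.80)–(2.81), `¾p` from the Gram bound).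
[cite: BenfattoGiulianiMastropietro2006, §2.8 (2.77)–(2.83)] -/
theorem bgmDelta_eq_of_even {p : ℕ} (hp : Even p) (h4 : 4 ≤ p) :
    bgmDelta p = 5 / 2 - 3 / 4 * (p : ℝ) + bgmSigma p := by
  unfold bgmDelta bgmSigma
  by_cases h8 : p ≤ 8
  · have h10 : ¬ 10 ≤ p := by omega
    rw [if_neg h10, if_pos ⟨h4, h8⟩]
    ring
  · have h10 : 10 ≤ p := by obtain ⟨r, hr⟩ := hp; omega
    rw [if_pos h10, if_neg (fun h => h8 h.2), if_pos h10]
    ring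

mutual
/-- `Σ_{v not e.p.} δ(|P_v|)` over the non-endpoint vertices of a (sub)tree ((2.77)). [cite: BenfattoGiulianiMastropietro2006, §2.8 (2.77)] -/
def GNTree.deltaSum : GNTree → ℝ
  | .endpt => 0
  | .vtx p cs => bgmDelta p + cs.deltaSum

/-- `Σ δ` over a forest. [cite: BenfattoGiulianiMastropietro2006, §2.8 (2.77)] -/
def GNForest.deltaSum : GNForest → ℝ
  | .nil => 0
  | .cons t f => t.deltaSum + f.deltaSum
end

mutual
/-- `Π_{v not e.p.} (1/s_v!) γ^{δ(|P_v|)}` ((2.77), `γ = 4`). [cite: BenfattoGiulianiMastropietro2006, §2.8 (2.77)] -/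
def GNTree.vertexWeight : GNTree → ℝ
  | .endpt => 1
  | .vtx p cs => (1 / (cs.len.factorial : ℝ)) * (4 : ℝ) ^ bgmDelta p * cs.vertexWeight

/-- The same product over a forest. [cite: BenfattoGiulianiMastropietro2006, §2.8 (2.77)] -/
def GNForest.vertexWeight : GNForest → ℝ
  | .nil => 1
  | .cons t f => t.vertexWeight * f.vertexWeight
end

/-- **Theorem 2.1 of BGM06 — the right-hand side of (2.77)** as a function of the tree skeleton:
`(c|U|)^n γ^{h(e_F - ¾|P_{v₀}|)} Π_{v not e.p.} (1/s_v!) γ^{δ(|P_v|)}` with `e_0 = 2`, `e_1 = 5/2`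
((2.77); Lemma 2.5 (2.98), file F2a: `e_3 = 3`, `e_5 = 7/2`), `δ` of (2.78), `γ = 4`.

THE PRINTED THEOREM (p0015:L58–L72), whose subject is NOT typed here (module doc, GAP): *Theorem 2.1.
Given `h_β ≤ h ≤ 0`, `τ ∈ 𝒯_{h,n}`, `P ∈ 𝒫_τ`, `T ∈ 𝐓`, if `E_j(k)` satisfies (2.36) for any `j ≥ h`,
`λ̃_{h_{v*}-1,Ω_{v*}}` satisfies (2.71a) for any endpoint `v* ∈ τ` and `U₀|h_β| = c₀` is small enough,
then `J^{(0)}_{h,n}(τ,P,T) ≤ (c|U|)^n γ^{h(2 - ¾|P_{v₀}|)} Π_{v not e.p.} (1/s_v!) γ^{δ(|P_v|)}` and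
`J^{(1)}_{h,n}(τ,P,T) ≤ (c|U|)^n γ^{h(5/2 - ¾|P_{v₀}|)} Π_{v not e.p.} (1/s_v!) γ^{δ(|P_v|)}` (2.77),
where `δ(p) = 1 - p/4 + 𝟙(p ≥ 10)` (2.78),* `J^{(F)}` being the sector sum (with `F` external sectors held
fixed) of the `L¹` norm of the modified tree value, (2.76).  The tree's single-scale form of this bound
in the sectorised norm is `SectorisedEffectiveActionBound.hubbardSectorKernelNorm_effAction_le`
(FACT-LIST F-006, FACT-unless-TREE: ref-2 rules). BGM06.T2.1 · Theorem 2.1 · p0015:L58.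
[cite: BenfattoGiulianiMastropietro2006, §2.8 Theorem 2.1 (2.77)] -/
def GNTree.bgmTreeBound (c U : ℝ) (h : ℤ) (eF : ℝ) (t : GNTree) : ℝ :=
  (c * |U|) ^ t.numEndpoints * (4 : ℝ) ^ ((h : ℝ) * (eF - 3 / 4 * (t.extLegs : ℝ))) * t.vertexWeight

/-- The external-sector exponents `e_F` of (2.77): `e_0 = 2`, `e_1 = 5/2` (the `F = 0` line follows from
`F = 1` by one more sector sum `Σ_{ω₁ ∈ O_h} = O(γ^{-h/2})`, p0016:L14). [cite: BenfattoGiulianiMastropietro2006, §2.8 (2.77)] -/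
def bgmExternalExp (F : ℕ) : ℝ := if F = 0 then 2 else 5 / 2

mutual
/-- **(2.80), exponent**: the Gram–Hadamard bound of the interpolated determinants contributes
`Σ_{v not e.p.} ¾h_v(Σ_{i=1}^{s_v}|P_{v_i}| - |P_v| - 2(s_v - 1))` to the exponent of `γ`, for the subtree
rooted at a vertex of scale `k` (children at `k+1`). BGM06.E2.80 · (2.80) · p0015:L125.
[cite: BenfattoGiulianiMastropietro2006, §2.8 (2.80)] -/
def GNTree.gramExp : GNTree → ℤ → ℝ
  | .endpt, _ => 0
  | .vtx p cs, k => 3 / 4 * (k : ℝ) * ((cs.sumExtLegs : ℝ) - p - 2 * ((cs.len : ℝ) - 1)) + cs.gramExp (k + 1)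

/-- (2.80) exponent summed over a forest whose roots sit at scale `k`. [cite: BenfattoGiulianiMastropietro2006, §2.8 (2.80)] -/
def GNForest.gramExp : GNForest → ℤ → ℝ
  | .nil, _ => 0
  | .cons t f, k => t.gramExp k + f.gramExp k
end

mutual
/-- **(2.81), exponent**: the `L¹` norms of the `s_v - 1` anchored-tree propagators of scale `h_v`
((2.52a), `j = 0`) contribute `-Σ_{v not e.p.} h_v(s_v - 1)`. BGM06.S2.8 · (2.81) · p0015:L129.
[cite: BenfattoGiulianiMastropietro2006, §2.8 (2.81)] -/
def GNTree.lineExp : GNTree → ℤ → ℝ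
  | .endpt, _ => 0
  | .vtx _ cs, k => -((k : ℝ) * ((cs.len : ℝ) - 1)) + cs.lineExp (k + 1)

/-- (2.81) exponent over a forest at scale `k`. [cite: BenfattoGiulianiMastropietro2006, §2.8 (2.81)] -/
def GNForest.lineExp : GNForest → ℤ → ℝ
  | .nil, _ => 0
  | .cons t f, k => t.lineExp k + f.lineExp k
end

mutual
/-- **(2.83), per-vertex part of the exponent**: `Σ_{v not e.p.} [-½m₄(v) + σ(|P_v|)]` (the root factor
`γ^{-½h·m₄(v₀)}` of (2.83) is added in `GNTree.sectorExp`). BGM06.S2.8 · (2.83) · p0016:L1.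
[cite: BenfattoGiulianiMastropietro2006, §2.8 (2.83)] -/
def GNTree.sectorVertexExp : GNTree → ℝ
  | .endpt => 0
  | .vtx p cs => -(1 / 2 * ((GNTree.vtx p cs).numEndpoints : ℝ)) + bgmSigma p + cs.sectorVertexExp

/-- (2.83) per-vertex exponent over a forest. [cite: BenfattoGiulianiMastropietro2006, §2.8 (2.83)] -/
def GNForest.sectorVertexExp : GNForest → ℝ
  | .nil => 0
  | .cons t f => t.sectorVertexExp + f.sectorVertexExp
end

/-- **(2.83), exponent**: the sector sums with one external sector fixed are bounded by
`c^n γ^{-½h·m₄(v₀)} Π_{v not e.p.} γ^{-½m₄(v) + ½(|P_v|-3)𝟙(4≤|P_v|≤8) + ½(|P_v|-1)𝟙(|P_v|≥10)}` — the total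
exponent of `γ` for a tree of root scale `h`. BGM06.S2.8 · (2.83) · p0016:L1. [cite: BenfattoGiulianiMastropietro2006, §2.8 (2.83)] -/
def GNTree.sectorExp (t : GNTree) (h : ℤ) : ℝ := -(1 / 2 * (h : ℝ) * (t.numEndpoints : ℝ)) + t.sectorVertexExp

mutual
/-- The telescoping invariant behind Theorem 2.1: for an admissible subtree whose root vertex sits at scale
`k`, the exponents of (2.80), (2.81) and the per-vertex part of (2.83) add up to
`(k-1)(5/2 - ¾|P_v|) + Σ_{w not e.p.} δ(|P_w|) + ½(k-1)m₄(v)` — the endpoint scales cancel.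
[cite: BenfattoGiulianiMastropietro2006, §2.8 proof of Theorem 2.1 (2.79)–(2.83)] -/
theorem GNTree.exponent_invariant : ∀ (t : GNTree) (k : ℤ), t.Admissible →
    t.gramExp k + t.lineExp k + t.sectorVertexExp =
      ((k : ℝ) - 1) * (5 / 2 - 3 / 4 * (t.extLegs : ℝ)) + t.deltaSum + 1 / 2 * ((k : ℝ) - 1) * (t.numEndpoints : ℝ)
  | .endpt, k, _ => by
      simp only [GNTree.gramExp, GNTree.lineExp, GNTree.sectorVertexExp, GNTree.extLegs, GNTree.deltaSum,
        GNTree.numEndpoints, Nat.cast_ofNat, Nat.cast_one]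
      ring
  | .vtx p cs, k, hadm => by
      have ih := GNForest.exponent_invariant cs (k + 1) hadm.2.2
      have hδ := bgmDelta_eq_of_even hadm.1 hadm.2.1
      simp only [GNTree.gramExp, GNTree.lineExp, GNTree.sectorVertexExp, GNTree.extLegs, GNTree.deltaSum,
        GNTree.numEndpoints, Int.cast_add, Int.cast_one] at ih ⊢
      linarith

/-- The invariant summed over a forest whose roots sit at scale `k`. [cite: BenfattoGiulianiMastropietro2006, §2.8 proof of Theorem 2.1 (2.79)–(2.83)] -/
theorem GNForest.exponent_invariant : ∀ (f : GNForest) (k : ℤ), f.Admissible →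
    f.gramExp k + f.lineExp k + f.sectorVertexExp =
      ((k : ℝ) - 1) * (5 / 2 * (f.len : ℝ) - 3 / 4 * (f.sumExtLegs : ℝ)) + f.deltaSum +
        1 / 2 * ((k : ℝ) - 1) * (f.numEndpoints : ℝ)
  | .nil, k, _ => by
      simp only [GNForest.gramExp, GNForest.lineExp, GNForest.sectorVertexExp, GNForest.len,
        GNForest.sumExtLegs, GNForest.deltaSum, GNForest.numEndpoints, Nat.cast_zero]
      ring
  | .cons t f, k, hadm => by
      have iht := GNTree.exponent_invariant t k hadm.1
      have ihf := GNForest.exponent_invariant f k hadm.2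
      simp only [GNForest.gramExp, GNForest.lineExp, GNForest.sectorVertexExp, GNForest.len,
        GNForest.sumExtLegs, GNForest.deltaSum, GNForest.numEndpoints, Nat.cast_add, Nat.cast_one]
      linarith
end

/-- **Theorem 2.1, the power counting** ("It is straightforward to check that Theorem (2.1) in the case
`F = 1` follows by combining the bounds (2.80), (2.81), (2.82) and (2.83)", p0016:L12): for every admissible
tree skeleton with root scale `h` (first vertex `v₀` at scale `h + 1`), the exponents of `γ` collected from
the Gram–Hadamard bound (2.80), the tree-line `L¹` norms (2.81) and the sector sums (2.83) add up EXACTLY to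
the exponent `h(5/2 - ¾|P_{v₀}|) + Σ_{v not e.p.} δ(|P_v|)` of the second line of (2.77) ((2.82)
contributes the factor `(C|U|)^n` and no power of `γ`).  PROVED by the telescoping invariant
`GNTree.exponent_invariant`. [cite: BenfattoGiulianiMastropietro2006, §2.8 Theorem 2.1 (2.77), proof (2.79)–(2.83)] -/
theorem GNTree.bgm_powerCounting (t : GNTree) (h : ℤ) (ht : t.Admissible) :
    t.gramExp (h + 1) + t.lineExp (h + 1) + t.sectorExp h =
      (h : ℝ) * (bgmExternalExp 1 - 3 / 4 * (t.extLegs : ℝ)) + t.deltaSum := by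
  have hinv := GNTree.exponent_invariant t (h + 1) ht
  simp only [Int.cast_add, Int.cast_one] at hinv
  rw [GNTree.sectorExp, bgmExternalExp, if_neg one_ne_zero]
  linarith

/-- The `F = 0` line of (2.77) from the `F = 1` line: one more sector sum over `ω₁ ∈ O_h` costs
`|O_h| = 2γ^{-h/2}`, i.e. `-h/2` in the exponent: `h·e_1 - h/2 = h·e_0` (p0016:L14–L18). [cite: BenfattoGiulianiMastropietro2006, §2.8 (2.77), case F = 0] -/
theorem bgmExternalExp_zero_eq (h : ℤ) :
    (h : ℝ) * bgmExternalExp 1 - (h : ℝ) / 2 = (h : ℝ) * bgmExternalExp 0 := by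
  rw [bgmExternalExp, bgmExternalExp, if_neg one_ne_zero, if_pos rfl]
  ring

/-! ### Small API and non-vacuity -/

/-- `δ(4) = 0`, `δ(6) = -½`, `δ(8) = -1`, `δ(10) = -½`: the printed values behind the Remark. [cite: BenfattoGiulianiMastropietro2006, §2.8 (2.78)] -/
theorem bgmDelta_values : bgmDelta 4 = 0 ∧ bgmDelta 6 = -1 / 2 ∧ bgmDelta 8 = -1 ∧ bgmDelta 10 = -1 / 2 := by
  refine ⟨?_, ?_, ?_, ?_⟩ <;> norm_num [bgmDelta]

/-- The trivial tree with one endpoint of type `λ` at scale `h + 2` (§2.6 item 5) and (2.62) with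
`s = 1`): `v₀` trivial with `|P_{v₀}| = 4`.  Its (2.77) data: `n = 1`, exponent `h(5/2 - 3) = -h/2`, one
vertex factor `γ^{δ(4)} = 1` — the dimensional bound `c|U|γ^{-h/2}` of a single sectorised quartic vertex
with one sector fixed (cf. (2.96)). [cite: BenfattoGiulianiMastropietro2006, §2.6 item 5)] -/
def GNTree.trivialQuartic : GNTree := .vtx 4 (.cons .endpt .nil)

/-- The trivial quartic tree is admissible and its power counting is `-h/2`. [cite: BenfattoGiulianiMastropietro2006, §2.8 (2.96)] -/
theorem GNTree.powerCounting_trivialQuartic (h : ℤ) :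
    GNTree.trivialQuartic.Admissible ∧
      (h : ℝ) * (bgmExternalExp 1 - 3 / 4 * (GNTree.trivialQuartic.extLegs : ℝ)) + GNTree.trivialQuartic.deltaSum =
        -(h : ℝ) / 2 := by
  refine ⟨⟨⟨2, rfl⟩, le_rfl, trivial, trivial⟩, ?_⟩
  simp only [GNTree.trivialQuartic, GNTree.extLegs, GNTree.deltaSum, GNForest.deltaSum, bgmExternalExp,
    if_neg one_ne_zero, bgmDelta, Nat.cast_ofNat]
  norm_num
  ring

end Literature.MathematicalPhysics.QuantumLattice.FermiRG
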